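import Summits.QuantumFields.BalabanUV.Beta.MultiscaleParametrixCubesKSites

/-!
# Beta / MultiscaleParametrixCubesMargin — THE HULLS OF THE CUBE FAMILY WITH A MARGIN: `cubeHullR` (radius `((d+2)M + mg)·S_j`), its five
# clauses, the K-SITES OF A BOX (bond ends carrying `∂h`, `supp Δ_ch`, cells where `h` is non-constant — all within `r₀ = ((d+2)M + 2dL)S_j + 1`
# of the corner), and THE MARGIN LEMMA: for `mg ≥ (2d + (8d+3)·L^A·e^{(log L∕R)(8d+3)})·L` every `d_n`-ball of radius `8d+2` about a K-site
# lies in the hull (MODEL; second file of the Route-C INSTANCE W5 of the (w4-d)-flat programme, claim «WRS-PARAMETRIX-FLAT» journal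
# l.25540; unit `b2b-balaban-beta-d4-p2`, GEN 12, MODEL crew)

WHY.  Brick (c) (`MultiscaleRemainderWRS.row_remK_mul_le`) needs the INTERIOR members of the local propagator `G′_□` at every row-site of
`K(h_□)`; the local members (17-D ∕ 19b-D, (W1) ∕ (W2)) are interior statements «the `d_n`-ball of radius `4d+1` ∕ `8d+2` lies in the hull».
Gen 10's `cubeHull` (radius `(d+2)M S_j`) only contains `supp h_□` and its bond-neighbours; this file enlarges it by a margin of `mg·S_j` and
proves the interiority from `MultiscaleLocalBall.dist_le_of_sdist_le` — one constant `mg(d, L, A, R)`, LEVEL-FREE.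
CONTENT (kernel, 0 sorry; ONE definition `cubeHullR`, reviewed): §1 `cubeHullR`, `cubeHullR_clauses` (`hχ`, `hχcell`, `hsite`, `hbond`, `hH` — gen 10's
`cubeHull_clauses` with the radius), `cubeHullR_eq_one_of_dist_le`; §3 `scale_le_of_dist_le` (`n ≤ L·S_j` on the `r₀`-ball) and
**`hullR_eq_one_of_sdist_le`** — THE MARGIN LEMMA (the sibling `MultiscaleParametrixCubesKSites.eq_one_of_sdist_le_of_ball` for `cubeHullR`).
The K-sites and the cell oscillation are in the (definition-free) sibling `MultiscaleParametrixCubesKSites`.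

HONEST FRAMING: discharging `BetaPertH` makes Bałaban's UV stability UNCONDITIONAL — NOT the continuum limit, NOT the
Clay problem.  HONEST DEPENDENCY (verbatim): «continuum YM on T⁴ ⇐ BetaPertH ∧ nine spine estimates (0/9 proved);
BetaPertH ⇐ (D1) ∧ (D4) ∧ CAP+tail; G-an2-4 gates asym, D1 and NE2/3/4.»  THIS MODULE DISCHARGES NOTHING of `BetaPertH`,
asserts NOTHING printed and cites nothing as a fact (ABSOLUTE RULE): [folklore] torus geometry of the MODEL's cube family; (G1)∕(G2)
and the counts are DATA.  LOCI (shape only): [B6] = `Balaban1984PropagatorsII` (2.1)–(2.2) p. 224, (2.36)–(2.37) p. 229; [B9] =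
`Balaban1985BackgroundPropagators` p. 408 (Ω₀(□)).  No class change on row D4 (critical-path width 0; D4 DISCHARGE NO DATE); NOT
BetaPertH, NOT continuum, NOT Clay, NOT summit progress.
-/

namespace Summit.QuantumFields.BalabanUV.Beta.MultiscaleParametrixCubesMargin

open Finset Function
open Summit.QuantumFields.BalabanUV.Beta.BoxPoincare (Box)
open Summit.QuantumFields.BalabanUV.Beta.MultiscaleCoerciveTorus
open Summit.QuantumFields.BalabanUV.Beta.MultiscaleDecayBudget
open Summit.QuantumFields.BalabanUV.Beta.MultiscaleDistance
open Summit.QuantumFields.BalabanUV.Beta.MultiscaleLocalBall (dist_le_of_sdist_le)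
open Literature.MathematicalPhysics.QuantumFieldTheory.Balaban1983to89
open Literature.MathematicalPhysics.QuantumFieldTheory.Balaban1983to89.B9Thm37GluePU (bsrc btgt bsrc_apply btgt_apply)
open Literature.MathematicalPhysics.QuantumFieldTheory.Balaban1983to89.B9Thm37GlueTorusCov (tblk torusComb)
open Literature.MathematicalPhysics.QuantumFieldTheory.Balaban1983to89.B9Thm37GlueTorusCovPoinc (tdepth_le)
open Literature.MathematicalPhysics.QuantumFieldTheory.Balaban1983to89.B9Thm37GlueTorusCovCT (abs_sub_base_le)
open B5TorusCover (UT Ctr ctrU)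
open B5Leibniz121 (up dist_up_le)
open Summit.QuantumFields.BalabanUV.Beta.MultiscaleRemainderLeibniz (lapH)
open Summit.QuantumFields.BalabanUV.Beta.MultiscaleParametrixHull
open Summit.QuantumFields.BalabanUV.Beta.MultiscaleCubesFamily
open Summit.QuantumFields.BalabanUV.Beta.MultiscaleParametrixCubes
open Summit.QuantumFields.BalabanUV.Beta.MultiscaleCubesGeometry (dist_cellPt_cellPt_le)
open Summit.QuantumFields.BalabanUV.Beta.MultiscaleParametrixBoxes (one_le_MS)
open Summit.QuantumFields.BalabanUV.Beta.MultiscaleParametrixCubesKSites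

noncomputable section

variable {d : ℕ} {N : Fin d → ℕ} [∀ i, NeZero (N i)] {J K : Type} [Fintype J] [Fintype K]
  (S : J → ℕ) (hS : ∀ l, 1 ≤ S l) (hdivS : ∀ l i, S l ∣ N i) (lvl : K → J) (zc : (k : K) → Ctr N (S (lvl k)))
  (M : ℕ) (hM : 1 ≤ M) (hMdiv : ∀ j i, M * S j ∣ N i) (inLayer : (j : J) → Ctr N (M * S j) → Prop)
  (hcover : ∀ x : UT N, ∃ k, ∃ v : Box d (S (lvl k)), cellPt S hS hdivS lvl zc k v = x)

/-! ## §1 The hull with a margin and its clauses -/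

open Classical in
/-- MODEL of Ω₀(□) WITH A MARGIN: for an ACTIVE box `(j,z)` the union of the family cells meeting the `(((d+2)M + mg)·S_j + 1)`-ball round
its corner, for an inactive box the empty hull (`mg = 0` is gen 10's `cubeHull`). [cite: Balaban1985BackgroundPropagators, p.408 (Ω₀(□)); Balaban1984PropagatorsII, (2.37) p.229] -/
def cubeHullR (mg : ℕ) (p : Σ j : J, Ctr N (M * S j)) (x : UT N) : ℝ :=
  if ∃ y, cubeFam S hS M hM hMdiv inLayer p y ≠ 0 then
    cellHull S hS hdivS lvl zc hcover (ctrU N (M * S p.1) p.2) (((d + 2) * M + mg) * S p.1) x else 0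

omit [Fintype J] [Fintype K] in
/-- The support radius sits inside the margin radius: `(d+2)·(M S_j) ≤ ((d+2)M + mg)·S_j`. [folklore] -/
theorem supp_radius_le (mg : ℕ) (j : J) : (((d + 2) * (M * S j) : ℕ) : ℝ) ≤ ((((d + 2) * M + mg) * S j : ℕ) : ℝ) := by
  have h : (d + 2) * (M * S j) ≤ ((d + 2) * M + mg) * S j := by nlinarith [Nat.zero_le (mg * S j)]
  exact_mod_cast h

omit [Fintype K] in
/-- The five hull clauses of `parametrix_torus_adapted` ∕ `parametrix_levelOp_wrs` for the hulls with margin: `hχ`, `hχcell`, `hsite`,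
`hbond`, and `hH` (hull scale `L·S_j`) under (G2) at the enlarged radius. [cite: Balaban1985BackgroundPropagators, p.408 (Ω₀(□))] -/
theorem cubeHullR_clauses [NeZero d]
    (hdisj : ∀ k k' v v', cellPt S hS hdivS lvl zc k v = cellPt S hS hdivS lvl zc k' v' → k = k') (mg : ℕ) {L : ℕ}
    (hballs : ∀ (j : J) (z : Ctr N (M * S j)), (∃ y, cubeFam S hS M hM hMdiv inLayer ⟨j, z⟩ y ≠ 0) →
      ∀ k, CellMeets S hS hdivS lvl zc k (ctrU N (M * S j) z) (((((d + 2) * M + mg) * S j : ℕ) : ℝ) + 1) → S (lvl k) ≤ L * S j) :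
    (∀ p x, cubeHullR S hS hdivS lvl zc M hM hMdiv inLayer hcover mg p x = 0 ∨
        cubeHullR S hS hdivS lvl zc M hM hMdiv inLayer hcover mg p x = 1) ∧
      (∀ p k v, cubeHullR S hS hdivS lvl zc M hM hMdiv inLayer hcover mg p (cellPt S hS hdivS lvl zc k v) =
        cubeHullR S hS hdivS lvl zc M hM hMdiv inLayer hcover mg p (ctrU N (S (lvl k)) (zc k))) ∧
      (∀ p x, cubeFam S hS M hM hMdiv inLayer p x ≠ 0 → cubeHullR S hS hdivS lvl zc M hM hMdiv inLayer hcover mg p x = 1) ∧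
      (∀ p b, (cubeFam S hS M hM hMdiv inLayer p (bsrc b) ≠ 0 ∨ cubeFam S hS M hM hMdiv inLayer p (btgt b) ≠ 0) →
        cubeHullR S hS hdivS lvl zc M hM hMdiv inLayer hcover mg p (bsrc b) = 1 ∧
          cubeHullR S hS hdivS lvl zc M hM hMdiv inLayer hcover mg p (btgt b) = 1) ∧
      (∀ p x, cubeHullR S hS hdivS lvl zc M hM hMdiv inLayer hcover mg p x = 1 → siteScale S hS hdivS lvl zc hcover x ≤ L * S p.1) := by
  classical
  have hsupp : ∀ (p : Σ j : J, Ctr N (M * S j)) x, cubeFam S hS M hM hMdiv inLayer p x ≠ 0 →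
      dist x (ctrU N (M * S p.1) p.2) ≤ ((((d + 2) * M + mg) * S p.1 : ℕ) : ℕ) :=
    fun p x hx => (cubeFam_supp S hS M hM hMdiv inLayer p x hx).trans (supp_radius_le S M mg p.1)
  refine ⟨fun p x => ?_, fun p k v => ?_, fun p x hx => ?_, fun p b hb => ?_, fun p x hx => ?_⟩
  · unfold cubeHullR; split_ifs; exacts [cellHull_zero_or_one S hS hdivS lvl zc hcover _ _ x, Or.inl rfl]
  · unfold cubeHullR; split_ifs; exacts [cellHull_cellPt S hS hdivS lvl zc hcover hdisj _ _ k v, rfl]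
  · unfold cubeHullR
    rw [if_pos ⟨x, hx⟩]
    exact hsite_of_supp S hS hdivS lvl zc hcover _ _ (hsupp p) x hx
  · unfold cubeHullR
    have hact : ∃ y, cubeFam S hS M hM hMdiv inLayer p y ≠ 0 := hb.elim (fun h => ⟨_, h⟩) fun h => ⟨_, h⟩
    rw [if_pos hact, if_pos hact]
    exact hbond_of_supp S hS hdivS lvl zc hcover _ _ (hsupp p) b hb
  · unfold cubeHullR at hx
    by_cases hact : ∃ y, cubeFam S hS M hM hMdiv inLayer p y ≠ 0
    · rw [if_pos hact] at hx
      obtain ⟨j, z⟩ := p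
      exact scale_le_of_cellHull S hS hdivS lvl zc hcover _ _ (hballs j z hact) x hx
    · rw [if_neg hact] at hx
      exact absurd hx (by norm_num)

omit [Fintype K] in
/-- **Sites within `((d+2)M + mg)·S_j + 1` of the corner of an ACTIVE box lie in its hull.** [folklore] -/
theorem cubeHullR_eq_one_of_dist_le (mg : ℕ) (p : Σ j : J, Ctr N (M * S j)) (hact : ∃ y, cubeFam S hS M hM hMdiv inLayer p y ≠ 0)
    {x : UT N} (hx : dist x (ctrU N (M * S p.1) p.2) ≤ ((((d + 2) * M + mg) * S p.1 : ℕ) : ℝ) + 1) :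
    cubeHullR S hS hdivS lvl zc M hM hMdiv inLayer hcover mg p x = 1 := by
  classical
  unfold cubeHullR
  rw [if_pos hact]
  exact cellHull_eq_one_of_dist_le S hS hdivS lvl zc hcover _ _ hx

/-! ## §3 The margin lemma: the `d_n`-balls of radius `8d+2` about the K-sites lie in the hull -/

section Margin

variable [NeZero d] (hdisj : ∀ k k' v v', cellPt S hS hdivS lvl zc k v = cellPt S hS hdivS lvl zc k' v' → k = k')

include hdisj

omit [Fintype K] in
/-- **Sites within `r₀ = ((d+2)M + 2dL)·S_j + 1` of the corner of an active box lie in the hull with margin and have scale `≤ L·S_j`**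
(margin `mg ≥ 2dL`, (G2) at the enlarged radius). [folklore] -/
theorem scale_le_of_dist_le {L : ℕ} (mg : ℕ) (hmg : (2 : ℝ) * d * L ≤ mg)
    (hballs : ∀ (j : J) (z : Ctr N (M * S j)), (∃ y, cubeFam S hS M hM hMdiv inLayer ⟨j, z⟩ y ≠ 0) →
      ∀ k, CellMeets S hS hdivS lvl zc k (ctrU N (M * S j) z) (((((d + 2) * M + mg) * S j : ℕ) : ℝ) + 1) → S (lvl k) ≤ L * S j)
    (p : Σ j : J, Ctr N (M * S j)) (hact : ∃ y, cubeFam S hS M hM hMdiv inLayer p y ≠ 0) (x : UT N)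
    (hx : dist x (ctrU N (M * S p.1) p.2) ≤ (((d + 2) * (M * S p.1) : ℕ) : ℝ) + 2 * d * (L * S p.1) + 1) :
    cubeHullR S hS hdivS lvl zc M hM hMdiv inLayer hcover mg p x = 1 ∧ (siteScale S hS hdivS lvl zc hcover x : ℝ) ≤ L * S p.1 := by
  classical
  have hSj : (1 : ℝ) ≤ S p.1 := by exact_mod_cast hS p.1
  have hx' : dist x (ctrU N (M * S p.1) p.2) ≤ ((((d + 2) * M + mg) * S p.1 : ℕ) : ℝ) + 1 := by
    have hm : (2 : ℝ) * d * L * S p.1 ≤ mg * S p.1 := mul_le_mul_of_nonneg_right hmg (by linarith)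
    push_cast at hx ⊢
    nlinarith
  have h1 := cubeHullR_eq_one_of_dist_le S hS hdivS lvl zc M hM hMdiv inLayer hcover mg p hact hx'
  refine ⟨h1, ?_⟩
  have h5 := (cubeHullR_clauses S hS hdivS lvl zc M hM hMdiv inLayer hcover hdisj mg hballs).2.2.2.2 p x h1
  exact_mod_cast h5

omit [Fintype K] in
/-- **THE MARGIN LEMMA**: graded sides `S_l = L^{e_l}` with the additive datum, and a margin
`mg ≥ (2d + (8d+3)·L^A·e^{(log L∕R)(8d+3)})·L`: for an ACTIVE box every site `x` within `r₀ = ((d+2)M + 2dL)·S_j + 1` of the corner has its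
`d_n`-ball of radius `8d+2` inside the hull with margin: `d_n(q,x) ≤ 8d+2 ⟹ χ_□(q) = 1` (`MultiscaleLocalBall.dist_le_of_sdist_le` at `x`, whose
scale is `≤ L·S_j`).  This is the interiority clause of the local members (W1)∕(W2) at every K-site of the box.
[cite: Balaban1985BackgroundPropagators, p.408 (Ω₀(□)); Balaban1984PropagatorsII, (2.37) p.229] [folklore] -/
theorem hullR_eq_one_of_sdist_le {L : ℕ} (hL : 1 ≤ L) (e : J → ℕ) (hSe : ∀ l, S l = L ^ e l) {R : ℝ} (hR : 0 < R) {A : ℕ}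
    (hadd : ∀ x y : UT N, |(e (lvl (cellOf S hS hdivS lvl zc hcover x)) : ℝ) - e (lvl (cellOf S hS hdivS lvl zc hcover y))| ≤
      A + sdist bsrc btgt (siteScale S hS hdivS lvl zc hcover) x y / R)
    (mg : ℕ) (hmg : (2 * d + (8 * d + 3) * ((L : ℝ) ^ A * Real.exp (Real.log L / R * (8 * d + 3)))) * L ≤ mg)
    (hballs : ∀ (j : J) (z : Ctr N (M * S j)), (∃ y, cubeFam S hS M hM hMdiv inLayer ⟨j, z⟩ y ≠ 0) →
      ∀ k, CellMeets S hS hdivS lvl zc k (ctrU N (M * S j) z) (((((d + 2) * M + mg) * S j : ℕ) : ℝ) + 1) → S (lvl k) ≤ L * S j)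
    (p : Σ j : J, Ctr N (M * S j)) (hact : ∃ y, cubeFam S hS M hM hMdiv inLayer p y ≠ 0) (x : UT N)
    (hx : dist x (ctrU N (M * S p.1) p.2) ≤ (((d + 2) * (M * S p.1) : ℕ) : ℝ) + 2 * d * (L * S p.1) + 1)
    (q : UT N) (hq : sdist bsrc btgt (siteScale S hS hdivS lvl zc hcover) q x ≤ 8 * d + 2) :
    cubeHullR S hS hdivS lvl zc M hM hMdiv inLayer hcover mg p q = 1 := by
  have hL0 : (0 : ℝ) ≤ L := Nat.cast_nonneg _
  have hSj : (1 : ℝ) ≤ S p.1 := by exact_mod_cast hS p.1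
  have hΓ0 : 0 ≤ (8 * d + 3) * ((L : ℝ) ^ A * Real.exp (Real.log L / R * (8 * d + 3))) := by positivity
  have h2dL : (2 : ℝ) * d * L ≤ mg := by nlinarith
  obtain ⟨-, hnx⟩ := scale_le_of_dist_le S hS hdivS lvl zc M hM hMdiv inLayer hcover hdisj mg h2dL hballs p hact x hx
  refine eq_one_of_sdist_le_of_ball S hS hdivS lvl zc hcover hL e hSe hR hadd _ (ctrU N (M * S p.1) p.2)
    (ρ₁ := ((((d + 2) * M + mg) * S p.1 : ℕ) : ℝ) + 1) (fun y hy => cubeHullR_eq_one_of_dist_le S hS hdivS lvl zc M hM hMdiv inLayer hcover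
      mg p hact hy) ?_ x hx hnx q hq
  -- the margin: `r₀ + (8d+3)Γ·(L S_j) ≤ ((d+2)M + mg)S_j + 1`
  have hm : (2 * d * L + (8 * d + 3) * ((L : ℝ) ^ A * Real.exp (Real.log L / R * (8 * d + 3))) * L) * (S p.1 : ℝ) ≤ mg * S p.1 :=
    mul_le_mul_of_nonneg_right (by nlinarith) (by linarith)
  push_cast
  nlinarith

end Margin


end

end Summit.QuantumFields.BalabanUV.Beta.MultiscaleParametrixCubesMargin
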